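import Summits.CriticalPhenomena.SAWScalingLimit.Theses.SAWRenewalTightness
import Summits.CriticalPhenomena.SAWScalingLimit.Theses.SAWExcursionCardy
import Summits.CriticalPhenomena.SAWScalingLimit.Theorems.SubseqIdentification.Negative.Necessity
import Summits.CriticalPhenomena.SAWScalingLimit.Theorems.SubseqIdentification.Negative.EndpointLoadBearing
import Summits.CriticalPhenomena.SAWScalingLimit.Theorems.SubseqIdentification.Negative.ProbabilityRedundant
import Literature.Probability.RandomPlanarGeometry.RestrictionMeasures
import Literature.Probability.RandomPlanarGeometry.RestrictionDensity
import Literature.Probability.RandomPlanarGeometry.RestrictionHullsHolds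
import Literature.Probability.RandomPlanarGeometry.CaratheodoryHalfPlaneProofs

/-!
# Line `restriction-character` for crux `SubseqIdentification` (stmt-CriticalPhenomena-0783) — an
# ALTERNATIVE DOCK registered by the crux-strategist (seat s1, 2026-08-17); it never touches the live
# skeleton `Lines/boundary_area_law.lean` (lead c4) nor its stubs.

THE CRUX (fixed, the route's decl; shared body `SAWRenewalTightness.SubseqIdentification` =
`SAWParafermion.SubseqIdentification` = …): every subsequential weak limit `μ` (along `s → 0⁺`) of the
critical `δℤ²` SAW laws of a Dobrushin domain `(D; a, b)` with endpoint approximation is the chordal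
SLE_{8/3} law of `(D; a, b)`.

THE LINE. Dock at the Lawler–Schramm–Werner RESTRICTION CHARACTERISATION FOR ONE MEASURE (LSW03
Prop. 3.3 (1) ⇒ (3), p. 5 result 2, Thm. 6.1) instead of at "`μ = SLE_κ` for some `κ`" (the dock S1 =
`stub_identificationUpToKappa` of `boundary-area-law`, where `κ` must then be pinned by an exponent or by
restriction rigidity). Pull `μ` back to `(ℍₒ; 0, ∞)` by a chordal uniformizer `φ` and look at ONE scalar
functional of `μ`, the AVOIDANCE FUNCTIONAL of `*`-hulls,
    `F(A) := μ { γ : γ ∩ φ(A ∩ ℍₒ) = ∅ }`      (lattice shadow: the RATIO OF PARTITION FUNCTIONS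
    `Z_{Ω ∖ φ(A), δ}(a_δ, b_δ) / Z_{Ω, δ}(a_δ, b_δ)`, by exact restriction of the `x_c^{|γ|}` weights).
If `F` is a CHARACTER of the hull semigroup (`F(A · A') = F(A) F(A')`, RC-a) that is DILATION INVARIANT
(`F(λA) = F(A)`, RC-b), then the filled pull-back of `μ` is a two-sided restriction measure `P_α`
(Prop. 3.3); if `μ` is carried by simple curves meeting `∂D` only at `a, b` (SIM = the shared item
`SAWExcursionCardy.SimpleSubseqLimits`, stmt-CriticalPhenomena-4514) then `α = 5/8` (p. 5 result 2) and
`P_{5/8}` is the SLE_{8/3} trace law (Thm. 6.1), so `μ` IS the chordal SLE_{8/3} law of `(D; a, b)` — the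
packaging of these three SLE-side steps for a law on `CurveClass ℂ` is the stub LSW1. NO `κ`, NO Loewner
chain, NO driving process, NO describability input, NO observable VALUE (the exponent `5/8` is OUTPUT):
the conformal content of the crux is isolated as the pair (RC-a, RC-b) — covariance of avoidance
probabilities under the hull-removal maps `D ∖ φ(A) → D` and under the one-parameter automorphism group
of `(D; a, b)` — and its lattice companion is SIMPLICITY (an arm-type tightness-class estimate, true
verbatim on sheared lattices) instead of the exact boundary exponent `2` of `boundary-area-law`.

  RC-a hull covariance of `F`  ∧  RC-b dilation invariance of `F`      (conformal; THE BET, two stubs)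
  SIM  `SimpleSubseqLimits` (stmt-4514, by name)                       (lattice; open, shared)
  LSW1 one-measure LSW characterisation                                (SLE side; known, L/XL to formalise)
  ⟹ `SubseqIdentification` BY NAME (`SubseqIdentification_of`, kernel-checked, no `sorry`).
ANCHORS (sorry-free, axioms standard): every restriction measure `P_α` is a dilation-invariant hull character ([LSW] Prop. 3.3
(3) ⇒ (1) in homomorphism form), and — UNCONDITIONALLY, from the tree's PROVED Thm. 6.1 `sle_restriction_eightThirds_holds` — the
SLE_{8/3} trace's avoidance functional in `(ℍₒ; 0, ∞)` satisfies RC-a and RC-b: the bet is consistent with the conjecture.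

STUBS (4): `stub_hullCovarianceOfLimits` (RC-a, conformal bet, XXL/open), `stub_dilationInvarianceOfLimits`
(RC-b, conformal bet, XXL/open), `stub_simpleSubseqLimits` (= the registered item stmt-4514 by name; lattice,
open), `stub_oneMeasureLSW` (LSW1; known mathematics over the tree's `RestrictionMeasures` vocabulary —
`RestrictionConfig.IsHullProduct`, `IsStarHull`, named facts `exists_isRestrictionMeasure_of_isHullMultiplicative`,
`IsRestrictionMeasure.eq_five_eighths_of_outer_simple`, `sle_restriction_eightThirds`, proved
`IsRestrictionMeasure.unique` — the LANDABLE work of the line, reusable by route SAWConfRestriction whose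
`LSWCharacterisation` is the FAMILY version needing full-limit covariance under ALL conformal maps). Every stub
is stated over TREE VOCABULARY ONLY (the avoidance sets are written out; no workfile-local definition), so each
lands verbatim as a `Theorems/…` file `--supports stmt-CriticalPhenomena-0783`.

DISPROOF USED (`Cruxes/SubseqIdentification/Disproof.lean`, cdisprove cycles 1–2, NO KILL; landed
`Theorems/SubseqIdentification/Negative/{EndpointLoadBearing, Necessity, ProbabilityRedundant}.lean` imported
so this file is checked against them):
* `subseqIdentification_false_without_endpointLimits / _fstLimit / _sndLimit` — HONOURED: RC-a/RC-b keep
  `SAW.IsEndpointApprox` and the convergence hypotheses verbatim; H = the endpoint limits is USED at the LSW1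
  step through the disprover's by-product `Negative.ae_endpoints_of_hyps` (a.e. `γ` runs from `a` to `b`) —
  without it the pulled-back configuration is not in `Ω` (Def. 3.1: `cl K ∩ ℝ = {0}`).
* `…_false_without_oneSided / _meshToZero` — HONOURED: every lattice clause is along `𝓝[>] 0`.
* `subseqIdentification_iff_withoutProb` — `IsProbabilityMeasure μ` kept (harmless).
* §3/§6 necessity (`subseqIdentification_of_sawScalingLimit`): RC-a/RC-b are implied by the crux (SLE_{8/3}
  pulled back is `P_{5/8}`: `F(A) = Φ'_A(0)^{5/8}` is a dilation-invariant character, Thm. 6.1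
  `sle_restriction_eightThirds` + Prop. 3.3 (3)⇒(1)); SIM is implied by the crux
  (`Theorems/SimpleSubseqLimits/Negative/SimpleSubseqLimitsNecessary.lean`); LSW1 is a theorem. No stub is
  beyond the conjecture.
* §5 reversibility debt: a corollary of the crux, constrains no stub (avoidance events are reversal-invariant).
* §6b describability necessity (`LimitsDescribable`): NOT an input of this line (it is an output).
* §8 item 9 (restriction κ-pin, used by lead c4 INSIDE the S1 dock): this line uses restriction as the DOCK,
  not as the pin; no `meshDomain` nesting lemma is a stub here (the lattice identity is only the heuristic
  behind RC-a; the statement is about `μ`).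
Negatives index (11 items, 2026-08-17): none bears (no all-δ tightness, no observable normalisation, no fugacity
deformation).
-/

noncomputable section

open MeasureTheory Filter Topology Set
open scoped NNReal ENNReal BoundedContinuousFunction Pointwise

namespace Summit.CriticalPhenomena.SAWScalingLimit.Cruxes.SubseqIdentification.RestrictionCharacter

open Literature.Probability.RandomPlanarGeometry Literature.Probability.LatticeModels
open Literature.Probability.Process (preWienerMeasure)
open UpperHalfPlane (upperHalfPlaneSet)
open Summit.CriticalPhenomena.SAWScalingLimit.Theses.SAWRenewalTightness (SubseqIdentification)
open Summit.CriticalPhenomena.SAWScalingLimit.Theses.SAWExcursionCardy (SimpleSubseqLimits)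

/-! ## The stubs -/

/-- **RC-a — HULL COVARIANCE OF THE AVOIDANCE FUNCTIONAL (conformal; THE BET, part 1; open, XXL).**
For every subsequential limit `μ` of the pushed critical SAW laws of `(D; a, b)` (hypotheses of the crux
verbatim) and every chordal uniformizing map `φ : ℍₒ → D` (`0 ↦ a`, `∞ ↦ b`), the pulled-back avoidance
functional `F(X) = μ{γ : γ.range ∩ φ(X ∩ ℍₒ) = ∅}` is a HOMOMORPHISM of the semigroup of `*`-hulls:
`F(A · A') = F(A) · F(A')` whenever `B = A · A'` (`RestrictionConfig.IsHullProduct A A' B`, i.e.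
`ℍₒ ∖ B = Φ_{A'}⁻¹(ℍₒ ∖ A)`; LSW03 §2 pp. 8–9, Prop. 3.3 (1) "𝒜₁-covariance" in homomorphism form).
Lattice heuristic: `F_δ(A ∪ A'') = F_δ(A'') · F^{Ω∖φ(A'')}_δ(A)` EXACTLY for lattice sets (restriction of the
`x_c^{|γ|}` weights, `SAW.law_setOf_exists_support_eq_eq`), so RC-a is PRECISELY the conformal invariance of
avoidance RATIOS of partition functions between the Dobrushin domains `D ∖ φ(A')` and `D` under the
hull-removal map `φ ∘ Φ_{A'} ∘ φ⁻¹` — the conformal half of the crux in scalar form. Implied by the crux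
(SLE_{8/3}: `F(A) = Φ'_A(0)^{5/8}`, multiplicative by the chain rule). No lattice mechanism is claimed
(`EmbeddingModulusUniqueness`: the square symmetry of `ℤ²` must be spent HERE; Kennedy's Monte Carlo
confirms the `Φ'^{5/8}` law for the square-lattice half-plane SAW to < 1%). [cite: LawlerSchrammWerner2003Restriction, Prop. 3.3 (1), §2 pp. 8–9] -/
theorem stub_hullCovarianceOfLimits :
    ∀ (D : DobrushinDomain) (a b : ℝ → Site 2), SAW.IsEndpointApprox D a b →
      ∀ (s : ℕ → ℝ) (μ : Measure (CurveClass ℂ)), Tendsto s atTop (𝓝[>] (0 : ℝ)) →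
        IsProbabilityMeasure μ →
        (∀ f : CurveClass ℂ →ᵇ ℝ,
          Tendsto (fun n => ∫ γ, f γ.curve ∂(SAW.law D.carrier (s n) (a (s n)) (b (s n))))
            atTop (𝓝 (∫ x, f x ∂μ))) →
        ∀ (φ : ConformalEquiv upperHalfPlaneSet D.carrier), D.IsChordalUniformizing φ →
          ∀ A A' B : Set ℂ, IsStarHull A → IsStarHull A' → RestrictionConfig.IsHullProduct A A' B →
            μ {c | Disjoint c.range ((fun z => φ z) '' (B ∩ upperHalfPlaneSet))} =
              μ {c | Disjoint c.range ((fun z => φ z) '' (A ∩ upperHalfPlaneSet))} *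
                μ {c | Disjoint c.range ((fun z => φ z) '' (A' ∩ upperHalfPlaneSet))} := by
  sorry

/-- **RC-b — DILATION INVARIANCE OF THE AVOIDANCE FUNCTIONAL (conformal; THE BET, part 2; open, XXL).**
Same setting: `F(r • A) = F(A)` for every `*`-hull `A` and `r > 0` — invariance of the avoidance
probabilities of `μ` under the one-parameter group of conformal automorphisms of `(D; a, b)`
(`φ ∘ (z ↦ r z) ∘ φ⁻¹`, the hyperbolic translations along the chord; LSW03 Prop. 3.3 (1) "Γ-invariance").
This is the part of the conformal content with NO lattice shadow at all (lattice dilations change the mesh: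
they relate `P_δ` to `P_{δ/r}`, i.e. different subsequences); it would follow from uniqueness of the full
limit + scale covariance, or from any identification. Implied by the crux. [cite: LawlerSchrammWerner2003Restriction, Prop. 3.3 (1), §2 p. 9] -/
theorem stub_dilationInvarianceOfLimits :
    ∀ (D : DobrushinDomain) (a b : ℝ → Site 2), SAW.IsEndpointApprox D a b →
      ∀ (s : ℕ → ℝ) (μ : Measure (CurveClass ℂ)), Tendsto s atTop (𝓝[>] (0 : ℝ)) →
        IsProbabilityMeasure μ →
        (∀ f : CurveClass ℂ →ᵇ ℝ,
          Tendsto (fun n => ∫ γ, f γ.curve ∂(SAW.law D.carrier (s n) (a (s n)) (b (s n))))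
            atTop (𝓝 (∫ x, f x ∂μ))) →
        ∀ (φ : ConformalEquiv upperHalfPlaneSet D.carrier), D.IsChordalUniformizing φ →
          ∀ A : Set ℂ, IsStarHull A → ∀ r : ℝ, 0 < r →
            μ {c | Disjoint c.range ((fun z => φ z) '' ((r • A) ∩ upperHalfPlaneSet))} =
              μ {c | Disjoint c.range ((fun z => φ z) '' (A ∩ upperHalfPlaneSet))} := by
  sorry

/-- **SIM — SIMPLICITY AND BOUNDARY AVOIDANCE OF SUBSEQUENTIAL LIMITS (lattice; open; the registered item
`SAWExcursionCardy.SimpleSubseqLimits`, stmt-CriticalPhenomena-4514, BY NAME).** Every subsequential limit is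
carried by simple curve classes whose range meets `∂D` only at the marked points. A macroscopic
non-self-touching / no-boundary-crawling estimate for the critical `ℤ²` SAW (6-arm- and boundary-3-arm-type
bounds; the shared open input of every passing idea of this crux, TRIAGE r1-1 sharpen 2); necessary for the
crux (`Theorems/SimpleSubseqLimits/Negative/SimpleSubseqLimitsNecessary.lean`). It replaces, in this dock, the
exact boundary exponent `2` (`stub_latticeAreaLaw`) of the S1 dock: for restriction measures the boundary
exponent is `2` for EVERY `α` (Friedrich–Werner), so an area law pins nothing here, while simplicity pins
`α = 5/8`. [cite: LawlerSchrammWerner2004SAW, §3.4.5] -/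
theorem stub_simpleSubseqLimits : SimpleSubseqLimits := by
  sorry

/-- **LSW1 — THE ONE-MEASURE LAWLER–SCHRAMM–WERNER CHARACTERISATION (SLE side; KNOWN mathematics, not
formalised in this form; L/XL).** Let `μ` be a probability law on curve classes carried by simple curves from
`a` to `b` INSIDE `D̄` meeting `∂D` only at `a, b` (the support clause `range ⊆ D̄` is load-bearing: a Dirac
mass at an EXTERIOR simple arc from `a` to `b` has `F ≡ 1`, a dilation-invariant character), and `φ : ℍₒ → D` a chordal uniformizer. If the pulled-back avoidance
functional of `μ` is a dilation-invariant homomorphism of the `*`-hull semigroup, then `μ` is the chordal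
SLE_{8/3} law of `(D; a, b)`. Route through the tree's `RestrictionMeasures` library: (1) the filled pull-back
`K = fill(φ⁻¹ ∘ γ)` is a.s. a configuration of `Ω` (`RestrictionConfig`; simple path from `0` to `∞` in
`ℍₒ`, `RestrictionConfig.IsSimplePath`) and `γ ↦ K` is measurable for the avoidance σ-field; (2) its law
`P` is `RestrictionConfig.IsScaleInvariant` and `RestrictionConfig.IsHullMultiplicative` (the hypotheses,
transported; `K ∩ A = ∅ ↔ γ ∩ φ(A ∩ ℍₒ) = ∅` for a simple `γ` off the boundary); (3) NAMED FACT
`exists_isRestrictionMeasure_of_isHullMultiplicative` (Prop. 3.3 (1)⇒(3)) ⇒ `IsRestrictionMeasure α P`;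
(4) NAMED FACT `IsRestrictionMeasure.eq_five_eighths_of_outer_simple` (p. 5 result 2) ⇒ `α = 5/8`;
(5) the SLE_{8/3} trace law is `P_{5/8}` (`sle_restriction_eightThirds`, Thm. 6.1; discharged pieces in
`HullRestrictionSLE*`, `SLERestriction*`) and `IsRestrictionMeasure.unique` (PROVED from Lemma 3.2) ⇒ the two
filled laws agree; (6) a law on SIMPLE curve classes with fixed endpoints is determined by the law of the
range (Lusin–Souslin on the injective Borel map `c ↦ c.range` restricted to simple classes) ⇒
`μ = (pre-Wiener).map Γ` for the SLE_{8/3} curve `Γ` of `(D; a, b)`, i.e. `IsSLELaw (8/3) D μ`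
(`exists_isSLECurve_eightThirds`, `IsSLECurve.map_eq_holds` for bookkeeping). Positivity `F(A) > 0` is a
CONSEQUENCE (Prop. 3.3), so no `ConfinementPositivity`-type input is needed. [cite: LawlerSchrammWerner2003Restriction, Prop. 3.3; Thm. 6.1; p. 5 result 2] -/
theorem stub_oneMeasureLSW :
    ∀ (D : DobrushinDomain) (φ : ConformalEquiv upperHalfPlaneSet D.carrier), D.IsChordalUniformizing φ →
      ∀ (μ : Measure (CurveClass ℂ)), IsProbabilityMeasure μ →
        (∀ᵐ c ∂μ, c.source = D.pt 0 ∧ c.target = D.pt 1) → (∀ᵐ c ∂μ, c.range ⊆ closure D.carrier) →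
        (∀ᵐ c ∂μ, c ∈ CurveClass.simple ∧ c.range ∩ frontier D.carrier ⊆ {D.pt 0, D.pt 1}) →
        (∀ A A' B : Set ℂ, IsStarHull A → IsStarHull A' → RestrictionConfig.IsHullProduct A A' B →
            μ {c | Disjoint c.range ((fun z => φ z) '' (B ∩ upperHalfPlaneSet))} =
              μ {c | Disjoint c.range ((fun z => φ z) '' (A ∩ upperHalfPlaneSet))} *
                μ {c | Disjoint c.range ((fun z => φ z) '' (A' ∩ upperHalfPlaneSet))}) →
        (∀ A : Set ℂ, IsStarHull A → ∀ r : ℝ, 0 < r →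
            μ {c | Disjoint c.range ((fun z => φ z) '' ((r • A) ∩ upperHalfPlaneSet))} =
              μ {c | Disjoint c.range ((fun z => φ z) '' (A ∩ upperHalfPlaneSet))}) →
        IsSLELaw ((8 : ℝ≥0) / 3) D μ := by
  sorry

/-! ## The composition -/

/-- **Composition `RC-a → RC-b → SIM → LSW1 → SubseqIdentification` (kernel-checked, no `sorry`).** Given the
crux hypotheses for `(D; a, b)`, `s`, `μ`: a chordal uniformizer `φ` exists
(`MarkedDomain.exists_isChordalUniformizing_holds`, PROVED — Riemann + Carathéodory + Möbius); `μ`-a.e. `γ`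
runs from `a` to `b` inside `D̄` (`Negative.ae_endpoints_of_hyps`, `Negative.ae_range_subset_closure_of_hyps`, PROVED —
this is where the load-bearing endpoint limits are spent); SIM gives simplicity and boundary avoidance; RC-a/RC-b give the dilation-invariant
character; LSW1 concludes `IsSLELaw (8/3) D μ`, the crux BY NAME. -/
theorem SubseqIdentification_of
    (hA : ∀ (D : DobrushinDomain) (a b : ℝ → Site 2), SAW.IsEndpointApprox D a b →
      ∀ (s : ℕ → ℝ) (μ : Measure (CurveClass ℂ)), Tendsto s atTop (𝓝[>] (0 : ℝ)) →
        IsProbabilityMeasure μ →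
        (∀ f : CurveClass ℂ →ᵇ ℝ,
          Tendsto (fun n => ∫ γ, f γ.curve ∂(SAW.law D.carrier (s n) (a (s n)) (b (s n))))
            atTop (𝓝 (∫ x, f x ∂μ))) →
        ∀ (φ : ConformalEquiv upperHalfPlaneSet D.carrier), D.IsChordalUniformizing φ →
          ∀ A A' B : Set ℂ, IsStarHull A → IsStarHull A' → RestrictionConfig.IsHullProduct A A' B →
            μ {c | Disjoint c.range ((fun z => φ z) '' (B ∩ upperHalfPlaneSet))} =
              μ {c | Disjoint c.range ((fun z => φ z) '' (A ∩ upperHalfPlaneSet))} *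
                μ {c | Disjoint c.range ((fun z => φ z) '' (A' ∩ upperHalfPlaneSet))})
    (hB : ∀ (D : DobrushinDomain) (a b : ℝ → Site 2), SAW.IsEndpointApprox D a b →
      ∀ (s : ℕ → ℝ) (μ : Measure (CurveClass ℂ)), Tendsto s atTop (𝓝[>] (0 : ℝ)) →
        IsProbabilityMeasure μ →
        (∀ f : CurveClass ℂ →ᵇ ℝ,
          Tendsto (fun n => ∫ γ, f γ.curve ∂(SAW.law D.carrier (s n) (a (s n)) (b (s n))))
            atTop (𝓝 (∫ x, f x ∂μ))) →
        ∀ (φ : ConformalEquiv upperHalfPlaneSet D.carrier), D.IsChordalUniformizing φ →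
          ∀ A : Set ℂ, IsStarHull A → ∀ r : ℝ, 0 < r →
            μ {c | Disjoint c.range ((fun z => φ z) '' ((r • A) ∩ upperHalfPlaneSet))} =
              μ {c | Disjoint c.range ((fun z => φ z) '' (A ∩ upperHalfPlaneSet))})
    (hS : SimpleSubseqLimits)
    (hL : ∀ (D : DobrushinDomain) (φ : ConformalEquiv upperHalfPlaneSet D.carrier), D.IsChordalUniformizing φ →
      ∀ (μ : Measure (CurveClass ℂ)), IsProbabilityMeasure μ →
        (∀ᵐ c ∂μ, c.source = D.pt 0 ∧ c.target = D.pt 1) → (∀ᵐ c ∂μ, c.range ⊆ closure D.carrier) →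
        (∀ᵐ c ∂μ, c ∈ CurveClass.simple ∧ c.range ∩ frontier D.carrier ⊆ {D.pt 0, D.pt 1}) →
        (∀ A A' B : Set ℂ, IsStarHull A → IsStarHull A' → RestrictionConfig.IsHullProduct A A' B →
            μ {c | Disjoint c.range ((fun z => φ z) '' (B ∩ upperHalfPlaneSet))} =
              μ {c | Disjoint c.range ((fun z => φ z) '' (A ∩ upperHalfPlaneSet))} *
                μ {c | Disjoint c.range ((fun z => φ z) '' (A' ∩ upperHalfPlaneSet))}) →
        (∀ A : Set ℂ, IsStarHull A → ∀ r : ℝ, 0 < r →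
            μ {c | Disjoint c.range ((fun z => φ z) '' ((r • A) ∩ upperHalfPlaneSet))} =
              μ {c | Disjoint c.range ((fun z => φ z) '' (A ∩ upperHalfPlaneSet))}) →
        IsSLELaw ((8 : ℝ≥0) / 3) D μ) :
    SubseqIdentification := by
  intro D a b hab s μ hs hμ hlim
  obtain ⟨φ, hφ⟩ := MarkedDomain.exists_isChordalUniformizing_holds D
  haveI := hμ
  have hends :=
    Summit.CriticalPhenomena.SAWScalingLimit.Theorems.SubseqIdentification.Negative.ae_endpoints_of_hyps
      hab hs hlim
  have hrange :=
    Summit.CriticalPhenomena.SAWScalingLimit.Theorems.SubseqIdentification.Negative.ae_range_subset_closure_of_hyps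
      hab hs hlim
  exact hL D φ hφ μ hμ hends hrange (hS D a b hab s μ hs hμ hlim)
    (hA D a b hab s μ hs hμ hlim φ hφ) (hB D a b hab s μ hs hμ hlim φ hφ)

/-- The crux from the four registered stubs. -/
theorem SubseqIdentification_proof : SubseqIdentification :=
  SubseqIdentification_of stub_hullCovarianceOfLimits stub_dilationInvarianceOfLimits
    stub_simpleSubseqLimits stub_oneMeasureLSW

/-! ## Sanity anchors (sorry-free) -/

/-- The avoidance functional takes the value `1` at the empty hull (non-vacuity of the character:
`A · ∅ = A`, `RestrictionConfig.isHullProduct_empty`). [folklore] -/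
theorem avoid_empty (μ : Measure (CurveClass ℂ)) [IsProbabilityMeasure μ] {V : Set ℂ}
    (φ : ConformalEquiv upperHalfPlaneSet V) :
    μ {c | Disjoint c.range ((fun z => φ z) '' ((∅ : Set ℂ) ∩ upperHalfPlaneSet))} = 1 := by
  simp

/-- RC-a at `A' = ∅` is consistent with `F(∅) = 1`: the product identity for `B = A · ∅ = A` reads
`F(A) = F(A) · 1`. [folklore] -/
theorem hullCovariance_empty_consistent (μ : Measure (CurveClass ℂ)) [IsProbabilityMeasure μ] {V : Set ℂ}
    (φ : ConformalEquiv upperHalfPlaneSet V) (A : Set ℂ) :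
    μ {c | Disjoint c.range ((fun z => φ z) '' (A ∩ upperHalfPlaneSet))} =
      μ {c | Disjoint c.range ((fun z => φ z) '' (A ∩ upperHalfPlaneSet))} *
        μ {c | Disjoint c.range ((fun z => φ z) '' ((∅ : Set ℂ) ∩ upperHalfPlaneSet))} := by
  simp


/-! ## SLE-side consistency anchor (sorry-free): every restriction measure `P_α` IS a dilation-invariant hull character

[LSW] Prop. 3.3 (3) ⇒ (1) in the homomorphism form used by RC-a/RC-b: if `P[K ∩ A = ∅] = Φ'_A(0)^α` for all `A ∈ 𝒬*`
then `A ↦ P[K ∩ A = ∅]` is multiplicative over hull products (chain rule `Φ'_{A·A'}(0) = Φ'_A(0) Φ'_{A'}(0)`,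
`IsHullProduct.restrictionDeriv_eq`) and dilation invariant (`Φ'_{rA}(0) = Φ'_A(0)`, `HasRestrictionDeriv.smulHull`).
In particular the filled SLE_{8/3} trace law (`P_{5/8}`, Thm. 6.1) satisfies the conclusions of RC-a/RC-b: the stubs are
consistent with the conjecture (the "known-theorem" falsifier of the line, run in Lean). -/

/-- A restriction measure `P_α` is hull-multiplicative ([LSW] Prop. 3.3 (3) ⇒ (1)). [cite: LawlerSchrammWerner2003Restriction, Prop. 3.3 (p. 11)] -/
theorem isHullMultiplicative_of_isRestrictionMeasure {α : ℝ} {P : Measure RestrictionConfig}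
    (h : IsRestrictionMeasure α P) : RestrictionConfig.IsHullMultiplicative P := by
  intro A A' B hA hA' hB
  obtain ⟨ΦA, hΦA, -⟩ := IsStarHull.existsUnique_isRestrictionMap_holds hA
  obtain ⟨ΦA', hΦA', -⟩ := IsStarHull.existsUnique_isRestrictionMap_holds hA'
  obtain ⟨ΦB, hΦB, -⟩ := IsStarHull.existsUnique_isRestrictionMap_holds hB.1
  obtain ⟨dA, hdA0, -, hdA⟩ := IsStarHull.exists_hasRestrictionDeriv_holds hA hΦA
  obtain ⟨dA', hdA'0, -, hdA'⟩ := IsStarHull.exists_hasRestrictionDeriv_holds hA' hΦA'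
  obtain ⟨dB, -, -, hdB⟩ := IsStarHull.exists_hasRestrictionDeriv_holds hB.1 hΦB
  have hprod : dB = dA * dA' :=
    Literature.Probability.RandomPlanarGeometry.IsHullProduct.restrictionDeriv_eq hA hA' hB hΦA hΦA' hΦB hdA hdA' hdB
  rw [h.2 hB.1 hΦB hdB, h.2 hA hΦA hdA, h.2 hA' hΦA' hdA', hprod,
    Real.mul_rpow hdA0.le hdA'0.le, ENNReal.ofReal_mul (Real.rpow_nonneg hdA0.le α)]

/-- A restriction measure `P_α` is dilation invariant ([LSW] Prop. 3.3 (3) ⇒ (1)). [cite: LawlerSchrammWerner2003Restriction, Prop. 3.3 (p. 11)] -/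
theorem isScaleInvariant_of_isRestrictionMeasure {α : ℝ} {P : Measure RestrictionConfig}
    (h : IsRestrictionMeasure α P) : RestrictionConfig.IsScaleInvariant P := by
  intro A hA r hr
  obtain ⟨Φ, hΦ, -⟩ := IsStarHull.existsUnique_isRestrictionMap_holds hA
  obtain ⟨d, -, -, hd⟩ := IsStarHull.exists_hasRestrictionDeriv_holds hA hΦ
  rw [h.2 hA hΦ hd, h.2 (hA.smul hr) (hΦ.smulHull hr) (hd.smulHull hr)]

/-- **RC-a holds for the conjectured limit in canonical coordinates (unconditional):** the avoidance functional of the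
chordal SLE_{8/3} trace in `(ℍₒ; 0, ∞)`, `A ↦ ℙ[γ[0,∞) ∩ A = ∅]`, is multiplicative over hull products — [LSW] Thm. 6.1
(`sle_restriction_eightThirds_holds`, PROVED in tree) with the chain rule `Φ'_{A·A'}(0) = Φ'_A(0) Φ'_{A'}(0)`. [folklore] -/
theorem sle_eightThirds_avoid_hullProduct {A A' B : Set ℂ} (hA : IsStarHull A) (hA' : IsStarHull A')
    (hB : RestrictionConfig.IsHullProduct A A' B) :
    preWienerMeasure {ω | Disjoint (range (sleTrace ((8 : ℝ≥0) / 3) ω)) B} =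
      preWienerMeasure {ω | Disjoint (range (sleTrace ((8 : ℝ≥0) / 3) ω)) A} *
        preWienerMeasure {ω | Disjoint (range (sleTrace ((8 : ℝ≥0) / 3) ω)) A'} := by
  obtain ⟨ΦA, hΦA, -⟩ := IsStarHull.existsUnique_isRestrictionMap_holds hA
  obtain ⟨ΦA', hΦA', -⟩ := IsStarHull.existsUnique_isRestrictionMap_holds hA'
  obtain ⟨ΦB, hΦB, -⟩ := IsStarHull.existsUnique_isRestrictionMap_holds hB.1
  obtain ⟨dA, hdA0, -, hdA⟩ := IsStarHull.exists_hasRestrictionDeriv_holds hA hΦA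
  obtain ⟨dA', hdA'0, -, hdA'⟩ := IsStarHull.exists_hasRestrictionDeriv_holds hA' hΦA'
  obtain ⟨dB, -, -, hdB⟩ := IsStarHull.exists_hasRestrictionDeriv_holds hB.1 hΦB
  have hprod : dB = dA * dA' :=
    Literature.Probability.RandomPlanarGeometry.IsHullProduct.restrictionDeriv_eq hA hA' hB hΦA hΦA' hΦB hdA hdA' hdB
  rw [sle_restriction_eightThirds_holds hB.1 hΦB hdB, sle_restriction_eightThirds_holds hA hΦA hdA,
    sle_restriction_eightThirds_holds hA' hΦA' hdA', hprod,
    Real.mul_rpow hdA0.le hdA'0.le, ENNReal.ofReal_mul (Real.rpow_nonneg hdA0.le _)]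

/-- **RC-b holds for the conjectured limit in canonical coordinates (unconditional):** the SLE_{8/3} avoidance
functional is dilation invariant, `ℙ[γ ∩ rA = ∅] = ℙ[γ ∩ A = ∅]` (`Φ'_{rA}(0) = Φ'_A(0)`). [folklore] -/
theorem sle_eightThirds_avoid_smul {A : Set ℂ} (hA : IsStarHull A) {r : ℝ} (hr : 0 < r) :
    preWienerMeasure {ω | Disjoint (range (sleTrace ((8 : ℝ≥0) / 3) ω)) (r • A)} =
      preWienerMeasure {ω | Disjoint (range (sleTrace ((8 : ℝ≥0) / 3) ω)) A} := by
  obtain ⟨Φ, hΦ, -⟩ := IsStarHull.existsUnique_isRestrictionMap_holds hA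
  obtain ⟨d, -, -, hd⟩ := IsStarHull.exists_hasRestrictionDeriv_holds hA hΦ
  rw [sle_restriction_eightThirds_holds hA hΦ hd,
    sle_restriction_eightThirds_holds (hA.smul hr) (hΦ.smulHull hr) (hd.smulHull hr)]

end Summit.CriticalPhenomena.SAWScalingLimit.Cruxes.SubseqIdentification.RestrictionCharacter
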